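/-
Copyright: statement-level skeleton of a published paper (lit-balaban cell, Phase-2 proof seat p25, gen 19). No proof
claims beyond what the kernel checks below.
-/
import Literature.MathematicalPhysics.QuantumFieldTheory.BalabanImbrieJaffe1984to88.BIJ88WalkScaledCutoff309
import Literature.MathematicalPhysics.QuantumFieldTheory.BalabanImbrieJaffe1984to88.BIJ88WalkIneq312Remainder

/-!
# `BalabanImbrieJaffe1984to88.BIJ88WalkDirectionCount312` — T. Bałaban, J. Imbrie, A. Jaffe, *Effective action and
cluster properties of the abelian Higgs model*, Commun. Math. Phys. **114** (1988) 257–315 [BalabanImbrieJaffe1988],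
§5.14 p. 311 [PDF 55], verbatim (x2 render `lit-balaban-r16/renders/cmp114/original-p055-x2.png`): *"We integrate by
parts in the Gaussian expectation (5.14.1). Each F^{m̄}_{k,loc}(X_{σ_1}) is a polynomial in A^{(k)}, φ^{(k)}; those fields
can be contracted via covariances C^{(k)}_{Λ₁₂^{(k)}} or C^{(k)}_{Λ₁₂^{(k)}}(u_{k+1}) to other observables, to χ′_{Λ₁₂^{(k)}},
or to the interaction."*, *"We stop integrating by parts fields in complete components of X̄."* and p. 312 [PDF 56]:
*"By performing sufficiently many integrations by parts, we have arranged for enough small factors to beat these large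
factors in the remainder terms (at least if X_{r′} is not at the boundary of Λ₁₂^{(k)})."* (v1.1 docfix D-g68-2, ref-5
g68 / r16 v2.284: v1.0 presented a paraphrased enumeration as verbatim; declarations untouched) — **THE NUMBER OF `χ′`-DIRECTIONS OF A TERM IS AT MOST THE LEG POTENTIAL `Φ₀(K)`** (p25 gen 19):
every step of the expansion lowers the potential `rpot` (gen 18, `BIJ88WalkRun311`) and a contraction to `χ′` pushes
exactly one direction, so `|dirs t| ≤ Φ(done, rest)` along `expand` (`run_dirs_rpot_le`, `expand_dirs_le_pot`) and
`|dirs t| ≤ Φ₀(K) = Σ_{j∈K}(|obs j| + 1 + M·maxArity)` for the expansion of a product of observables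
(`expand_dirs_length_le_phi0`); this discharges the cap `N` of `BIJ88WalkScaledCutoff309.remainder_expectation_le_scaled`
with `N = Φ₀(O)` (`remainder_expectation_le_scaled_phi0`).

statement-level skeleton of published theorems with citation tags; proofs where landed; nothing here is a claim
about the Yang–Mills mass gap

PDF held: `paper:balaban1988-cmp114-bij-abelian-higgs-effective-action` (journal page = PDF page + 256); p. 311–312 =
PDF 55–56 (re-read this session, 2026-08-23).

CITATION HEADER (lean-in-tree rule).  lit-balaban cell (HOME `run/shared/lean/pub/lit-balaban/`), Phase 2, seat p25
gen 19; row **C2.Claim@312** of `HOME/lit-balaban-r16/ROWS-C2-part2.md` (owner r16, referee ref-5; head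
`BIJ88Sect5StatementsPart4.Ineq312` untouched — MEMBER of the row).  USED BY NAME, nothing restated:
`BIJ88WalkRun311.{rpot, rpot_pair, rpot_pristine, rpot_absorb, rpot_drop, rpot_vertex, WGrp.nv_lt_of_not_complete}`,
`BIJ88WalkRunEnv311.{run_ind', run_rest_subset}`, `BIJ88WalkTermCount312.{pot, expand_pot_key}` (p25 gen 18),
`BIJ88WalkIneq312Remainder.phi0`, `BIJ88WalkScaledCutoff309.remainder_expectation_le_scaled` (p25 gen 19).

## What is proved (0 `sorry`, standard axioms, no new `Prop` facts; theorems only)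

* **`run_dirs_rpot_le`**, **`expand_dirs_le_pot`**, **`expand_dirs_length_le_phi0`**,
  **`remainder_expectation_le_scaled_phi0`**.
HONEST SCOPE: bookkeeping on the abstract expansion plus the assembly with `BIJ88WalkScaledCutoff309` (whose honest
scope applies: `K`, `K_V`, `Λ` hypotheses; shell gain not combined).  NOT summit progress; NOT continuum; NOT Clay.
Imports `BIJ88WalkScaledCutoff309`, `BIJ88WalkIneq312Remainder`; modifies nothing.
-/

noncomputable section

namespace Literature.MathematicalPhysics.QuantumFieldTheory.BalabanImbrieJaffe1984to88.BIJ88WalkDirectionCount312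

open Classical MeasureTheory Matrix Finset
open scoped BigOperators ContDiff
open Literature.MathematicalPhysics.QuantumFieldTheory.Balaban1983to89
open BIJ88PolymerRep5134 (corner)
open BIJ88PolymerRep5134Gauss (prec src)
open BIJ88SlotMomentsGauss308 (fieldLaw)
open BIJ88VertexIbp311 (vexp)
open BIJ88WickDerivatives305 (dlist)
open BIJ88VertexComponents311 (maxArity)
open BIJ88LabelledRun311 (mem_mbind)
open BIJ88WalkRun311 BIJ88WalkRunEnv311 BIJ88WalkExpansion311 BIJ88WalkTermCount312 BIJ88WalkIneq312Remainder
  BIJ88WalkScaledCutoff309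

variable {S : Type} [Fintype S] {ι : Type} [Fintype ι] {κ : Type} [LinearOrder κ] {P : Type} [Fintype P]
variable {Cov : P → Matrix S S ℝ} {trig : P → Bool} {f : S → ℝ} {c : ι → ℝ} {legs : ι → List (S → ℝ)}
  {obs : κ → List (S → ℝ)} {M : ℕ}

/-! ## §1  Along a run: each `χ′`-direction costs one unit of potential -/

/-- **Each contraction to `χ′` pushes one direction and lowers the potential**: for every outcome `o` of a run,
`|D(o)| + rpot(o) ≤ rpot(start)`. [cite: BalabanImbrieJaffe1988, §5.14 p.311] -/
theorem run_dirs_rpot_le (g : WGrp S κ ι P) (rest : Finset κ) (done : Multiset (WGrp S κ ι P)) :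
    ∀ o ∈ run Cov trig f c legs obs M g rest done,
      o.D.length + rpot obs M (maxArity legs) o.g o.rest o.done ≤ rpot obs M (maxArity legs) g rest done := by
  refine run_ind' (Q := fun g rest done o => o.D.length + rpot obs M (maxArity legs) o.g o.rest o.done
      ≤ rpot obs M (maxArity legs) g rest done) (fun _ _ _ _ => by simp) ?_ ?_ ?_ ?_ ?_ ?_ g rest done
  · intro g rest done u L p _ hp i o _ h
    simp only [WOut.scale_g, WOut.scale_rest, WOut.scale_done, WOut.scale_D] at h ⊢
    exact h.trans (rpot_pair obs M _ rest done hp i _ _).le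
  · intro g rest done u L p _ hp j hj i o _ h
    simp only [WOut.scale_g, WOut.scale_rest, WOut.scale_done, WOut.scale_D] at h ⊢
    exact h.trans (rpot_pristine obs M _ rest done hp hj i _ _ _).le
  · intro g rest done u L p _ hp h hh i _ o _ h'
    simp only [WOut.scale_g, WOut.scale_rest, WOut.scale_done, WOut.scale_D] at h' ⊢
    exact h'.trans (rpot_absorb obs M _ rest done trig hp hh i p).le
  · intro g rest done u L p _ hp o _ h
    simp only [WOut.scale_g, WOut.scale_rest, WOut.scale_done, WOut.scale_D] at h ⊢
    exact h.trans (rpot_drop obs M _ rest done hp _ _ _).le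
  · intro g rest done u L p _ hp o _ h
    simp only [WOut.push_g, WOut.push_rest, WOut.push_done, WOut.push_D, List.length_cons] at h ⊢
    have := rpot_drop obs M (maxArity legs) rest done hp (g.nchi + 1) (p ::ₘ g.pcs) (g.nw + (trig p).toNat)
    omega
  · intro g rest done u L p hc hp m j o _ h
    simp only [WOut.bump_g, WOut.bump_rest, WOut.bump_done, WOut.bump_D, WOut.scale_g, WOut.scale_rest,
      WOut.scale_done, WOut.scale_D] at h ⊢
    exact h.trans (rpot_vertex obs M rest done legs hp (WGrp.nv_lt_of_not_complete hc) m j _ _).le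

/-! ## §2  Along the expansion -/

/-- **THE NUMBER OF `χ′`-DIRECTIONS OF A TERM IS AT MOST THE POTENTIAL OF ITS STATE**: `|dirs t| ≤ Φ(done, rest)`
for every term of `expand done rest`. [cite: BalabanImbrieJaffe1988, §5.14 p.311–312] -/
theorem expand_dirs_le_pot : ∀ (n : ℕ) (done : Multiset (WGrp S κ ι P)) (rest : Finset κ), rest.card < n →
    ∀ t ∈ expand Cov trig f c legs obs M done rest, t.dirs.length ≤ pot obs M (maxArity legs) done rest
  | 0, _, _, hn => fun _ _ => absurd hn (Nat.not_lt_zero _)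
  | n + 1, done, rest, hn => by
    intro t ht
    by_cases h : rest.Nonempty
    · rw [expand_of_nonempty Cov trig f c legs obs M h, mem_mbind] at ht
      obtain ⟨o, ho, ht⟩ := ht
      have hcard : o.rest.card < n := lt_of_lt_of_le (lt_of_le_of_lt (Finset.card_le_card (run_rest_subset _ _ _ o ho))
        (Finset.card_erase_lt_of_mem (rest.min'_mem h))) (Nat.lt_succ_iff.1 hn)
      have hrun := run_dirs_rpot_le (Cov := Cov) (trig := trig) (f := f) (c := c) (legs := legs) (obs := obs) (M := M)
        _ _ _ o ho
      split_ifs at ht with hg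
      · rw [Multiset.mem_map] at ht
        obtain ⟨t', ht', rfl⟩ := ht
        have IH := expand_dirs_le_pot n o.done o.rest hcard t' ht'
        have hkey := expand_pot_key (Cov := Cov) (trig := trig) (f := f) (c := c) (legs := legs) (obs := obs) (M := M)
          h done o ho 0 (Nat.zero_le _)
        simp only [WTerm.addConst, oact_dirs, List.length_append]
        omega
      · rw [Multiset.mem_map] at ht
        obtain ⟨t', ht', rfl⟩ := ht
        have IH := expand_dirs_le_pot n (o.g ::ₘ o.done) o.rest hcard t' ht'
        have hkey := expand_pot_key (Cov := Cov) (trig := trig) (f := f) (c := c) (legs := legs) (obs := obs) (M := M)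
          h done o ho o.g.pend.length le_rfl
        have e : pot obs M (maxArity legs) (o.g ::ₘ o.done) o.rest
            = o.g.pend.length + pot obs M (maxArity legs) o.done o.rest := by
          simp only [pot, Multiset.map_cons, Multiset.sum_cons]; ring
        simp only [oact_dirs, List.length_append]
        omega
    · rw [expand_of_not_nonempty Cov trig f c legs obs M h, Multiset.mem_singleton] at ht
      subst ht
      simp

/-- **`|dirs t| ≤ Φ₀(K)`** for every term of the expansion of the product of the observables `K` (nothing set aside).
[cite: BalabanImbrieJaffe1988, §5.14 p.312] -/
theorem expand_dirs_length_le_phi0 (K : Finset κ) :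
    ∀ t ∈ expand Cov trig f c legs obs M 0 K, t.dirs.length ≤ phi0 legs obs M K := by
  intro t ht
  have h := expand_dirs_le_pot (Cov := Cov) (trig := trig) (f := f) (c := c) (legs := legs) (obs := obs) (M := M)
    _ 0 K (Nat.lt_succ_self _) t ht
  simpa [pot, phi0] using h

/-! ## §3  The expectation bound for a scaled cutoff with the cap discharged -/

section Law

variable {α I : Type} [Fintype α] [DecidableEq α] [Fintype I] [DecidableEq I]
  {blk : α → I} {Δ : Matrix α α ℝ} {ℱ : α → ℝ} {W : Finset I}

/-- **`BIJ88WalkScaledCutoff309.remainder_expectation_le_scaled` WITH `N = Φ₀(O)`**: for the scaled cutoff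
`χ(Φ) = h(Φ/p)` (`‖D^nh‖ ≤ K` for `n ≤ Φ₀(O)`, `|e^{−V}| ≤ K_V`, `p > 0`) and the moment bound `𝔼_W|Π legs Φ| ≤ Λ`,
every remainder term of `expand 0 O` obeys `|𝔼_W[Π_{legs}Φ·(Π_{dirs t}∂)χ·e^{−V}]| ≤ (K·K_V)·Π_{z∈dirs t}(p^{−1}‖z‖)·Λ`.
[cite: BalabanImbrieJaffe1988, §5.14 p.309, 312] -/
theorem remainder_expectation_le_scaled_phi0 (hPD : (prec blk Δ W (corner ℝ W)).PosDef)
    {Cov : P → Matrix {x : α // blk x ∈ W} {x : α // blk x ∈ W} ℝ} {trig : P → Bool} {c : ι → ℝ}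
    {legs : ι → List ({x : α // blk x ∈ W} → ℝ)} {obs : κ → List ({x : α // blk x ∈ W} → ℝ)} {M : ℕ}
    {h : ({x : α // blk x ∈ W} → ℝ) → ℝ} (hh : ContDiff ℝ ∞ h) {K KV p Λ : ℝ} (hK0 : 0 ≤ K) {O : Finset κ}
    (hK : ∀ n ≤ phi0 legs obs M O, ∀ φ, ‖iteratedFDeriv ℝ n h φ‖ ≤ K) (hV : ∀ φ, |vexp c legs φ| ≤ KV) (hp : 0 < p)
    (hmom : ∀ t ∈ expand Cov trig (src blk ℱ W) c legs obs M 0 O, t.consts = 0 →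
      ∫ φ, |((t.groups.map fun g => (g.pend : Multiset _)).sum.map fun w => φ ⬝ᵥ w).prod| ∂(fieldLaw blk Δ ℱ W) ≤ Λ) :
    ∀ t ∈ expand Cov trig (src blk ℱ W) c legs obs M 0 O, t.consts = 0 →
      |∫ φ, ((t.groups.map fun g => (g.pend : Multiset _)).sum.map fun w => φ ⬝ᵥ w).prod
          * (dlist t.dirs (fun ψ => h (p⁻¹ • ψ)) φ * vexp c legs φ) ∂(fieldLaw blk Δ ℱ W)|
        ≤ K * KV * (t.dirs.map fun z => p⁻¹ * ‖z‖).prod * Λ :=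
  remainder_expectation_le_scaled hPD hh hK0 hK hV hp
    (fun t ht _ => expand_dirs_length_le_phi0 (Cov := Cov) (trig := trig) (c := c) O t ht) hmom

end Law

end Literature.MathematicalPhysics.QuantumFieldTheory.BalabanImbrieJaffe1984to88.BIJ88WalkDirectionCount312

end
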